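import Mathlib.Analysis.PSeries
import Mathlib.Analysis.SpecialFunctions.Pow.Real
import Literature.NumberTheory.LFunctions.WeilMellinBounds
import HarnessLib

/-!
# Adversarial Weil positivity (posited object of route `WeilAdversary`)

Sibling of `Literature/NumberTheory/LFunctions/WeilExplicit.lean` (same normalisation: test functions
`IsWeilTest g`, transform `weilMellin g s = ĝ(s) = ∫ g(t) e^{(s - 1/2)t} dt`, involution
`weilReflect`, convolution `weilConv`; Weil positivity on the truncated cone `WeilPositivityOn a`).

By the explicit formula, `Re Q(g) = Re ∑_ρ m(ρ) k̂(ρ)` with `k = g ⋆ g̃`, `k̂ = weilMellin k`, the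
sum running over the non-trivial zeros of `ζ`. The route *WeilAdversary*
(`Summits/RiemannHypothesis/RiemannHypothesis/Theses/WeilAdversary.lean`, card
`weil-ladder-adversary`) asks what ZERO COUNTING (an explicit Riemann–von Mangoldt band) plus the
Riemann hypothesis VERIFIED up to a height `T₀` can certify about the sign of this zero side, by
letting an adversary place the "zeros". The present file names that posited object once, so that
the four route items (`SamplingRungTwo`, `SamplingEngine`, `CountingNoGo`, `AdversaryTransfer`) are
syntactic instances of it (they unfold to it by `Iff.rfl`), and proves the bookkeeping lemmas the
route's provers need.

## Contents

* `AdversarialWeilPositivity a T₀ c₁ c₂ c₀` — THE DEFINITION (verbatim the block inlined in the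
  route items): for every enumeration `ρ : ℕ → ℂ` (repetition = multiplicity) of points of the
  upper half of the open critical strip which lie on the critical line up to height `T₀`, are
  locally finite in height, and whose counting function stays, for `T ≥ T₀`, within
  `c₁ log T + c₂ log log T + c₀` of the Riemann–von Mangoldt main term `(T/2π) log (T/2πe)`, and
  for every Weil test function `g` supported in `[-a, a]`:
  `0 ≤ Re ∑' n, (k̂(ρ n) + k̂(conj (ρ n)))`, `k = g ⋆ g̃`.
  Conjugate (lower half-plane) points are added INSIDE the sum; the symmetry `ρ ↦ 1 - ρ̄` is
  deliberately not imposed.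
* `IsWeilAdversary T₀ c₁ c₂ c₀ ρ` — the four admissibility hypotheses bundled as a structure, and
  `weilAdversaryTerm g s = k̂(s) + k̂(s̄)`; `adversarialWeilPositivity_iff` is the bundled reading.
* Monotonicity: antitone in the support `a` (`AdversarialWeilPositivity.anti`,
  `antitone_adversarialWeilPositivity`); antitone in the band (`.of_band_le`, `.anti_consts`:
  a wider band admits more configurations, hence is a stronger statement); the degenerate supports
  `a ≤ 0` hold trivially (`adversarialWeilPositivity_of_nonpos`: the only test function is `0`).
  Monotonicity in `T₀` is NOT an inclusion of admissible classes (raising `T₀` strengthens the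
  on-line constraint but weakens the band constraint, which is only imposed for `T ≥ T₀`), so no
  such lemma is stated.
* Junk-safety of the `∑'`: for an admissible configuration the counting band forces
  `#{n | k < Im ρₙ ≤ k + 1} = O(log k)`, hence `∑ₙ 1/(1 + (Im ρₙ)²) < ∞`
  (`IsWeilAdversary.summable_one_div_one_add_im_sq`), and with the strip decay
  `‖k̂(s)‖ ≤ C_k/(1 + (Im s)²)` (`norm_weilMellin_le`) the series in the definition converges
  absolutely (`IsWeilAdversary.summable_norm_weilAdversaryTerm`, `.summable_weilAdversaryTerm`,
  `.re_tsum_weilAdversaryTerm`). So the `tsum` in the definition is never the junk value `0` for a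
  summability reason, and a refutation must exhibit a genuinely negative convergent sum.

This is a posited object of a route, not a notion from the literature: [folklore]-shaped
definition, no citation. The transfer "true zeros are an admissible configuration"
(`AdversaryTransfer`) is a route item and is left to the route's provers.
-/

noncomputable section

open Complex Filter Set MeasureTheory
open scoped Real Topology ComplexConjugate ContDiff

namespace Literature.NumberTheory.LFunctions

/-! ## The definition -/

/-- **Adversarial Weil positivity** `AdvPos(a; T₀; c₁, c₂, c₀)` (posited object of route
`WeilAdversary`, card `weil-ladder-adversary`). For every enumeration `ρ : ℕ → ℂ` (repetition =
multiplicity) with `0 < Re ρₙ < 1`, `0 < Im ρₙ`, `Im ρₙ ≤ T₀ → Re ρₙ = 1/2` (RH verified to height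
`T₀`), `{n | Im ρₙ ≤ T}` finite for every `T`, and the explicit Riemann–von Mangoldt band
`|#{n | Im ρₙ ≤ T} - (T/2π) log (T/2πe)| ≤ c₁ log T + c₂ log log T + c₀` for `T ≥ T₀`, and for
every Weil test function `g` with `tsupport g ⊆ [-a, a]`:
`0 ≤ Re ∑'ₙ (k̂(ρₙ) + k̂(ρ̄ₙ))`, where `k̂ = weilMellin (weilConv g (weilReflect g))`.
Conjugate points are added inside the sum; the `ρ ↦ 1 - ρ̄` symmetry is NOT imposed. The block is
verbatim the one inlined in the route items `SamplingRungTwo`, `SamplingEngine`, `CountingNoGo`,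
`AdversaryTransfer`, which are therefore instances of this definition by `Iff.rfl`. For admissible
`ρ` the series converges absolutely (`IsWeilAdversary.summable_norm_weilAdversaryTerm`), so the
`∑'` is not a junk `0`. [folklore] -/
def AdversarialWeilPositivity (a T₀ c₁ c₂ c₀ : ℝ) : Prop := ∀ ρ : ℕ → ℂ, (∀ n, 0 < (ρ n).re ∧ (ρ n).re < 1 ∧ 0 < (ρ n).im) → (∀ n, (ρ n).im ≤ T₀ → (ρ n).re = 1 / 2) → (∀ T : ℝ, {n | (ρ n).im ≤ T}.Finite) → (∀ T : ℝ, T₀ ≤ T → |({n | (ρ n).im ≤ T}.ncard : ℝ) - T / (2 * Real.pi) * Real.log (T / (2 * Real.pi * Real.exp 1))| ≤ c₁ * Real.log T + c₂ * Real.log (Real.log T) + c₀) → ∀ g : ℝ → ℂ, IsWeilTest g → tsupport g ⊆ Set.Icc (-a) a → 0 ≤ (∑' n, (weilMellin (weilConv g (weilReflect g)) (ρ n) + weilMellin (weilConv g (weilReflect g)) (starRingEnd ℂ (ρ n)))).re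

/-! ## Bundled reading: admissible configurations and the symmetrised term -/

/-- Admissible ("band-admissible") configurations of the adversary with parameters
`(T₀; c₁, c₂, c₀)`: the four hypotheses of `AdversarialWeilPositivity` on an enumeration
`ρ : ℕ → ℂ` — open upper half-strip, on the critical line up to height `T₀`, locally finite in
height, counting function within the explicit Riemann–von Mangoldt band above `T₀`. [folklore] -/
structure IsWeilAdversary (T₀ c₁ c₂ c₀ : ℝ) (ρ : ℕ → ℂ) : Prop where
  /-- every point lies in the upper half of the open critical strip -/
  strip : ∀ n, 0 < (ρ n).re ∧ (ρ n).re < 1 ∧ 0 < (ρ n).im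
  /-- up to the verified height the points lie on the critical line -/
  on_line : ∀ n, (ρ n).im ≤ T₀ → (ρ n).re = 1 / 2
  /-- local finiteness in height -/
  finite : ∀ T : ℝ, {n | (ρ n).im ≤ T}.Finite
  /-- the explicit Riemann–von Mangoldt band above `T₀` -/
  band : ∀ T : ℝ, T₀ ≤ T →
    |({n | (ρ n).im ≤ T}.ncard : ℝ) - T / (2 * Real.pi) * Real.log (T / (2 * Real.pi * Real.exp 1))|
      ≤ c₁ * Real.log T + c₂ * Real.log (Real.log T) + c₀

/-- The symmetrised zero-side term of the adversary sum attached to a test function `g` at a point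
`s`: `k̂(s) + k̂(s̄)` with `k = g ⋆ g̃`, `k̂ = weilMellin k`. [folklore] -/
def weilAdversaryTerm (g : ℝ → ℂ) (s : ℂ) : ℂ :=
  weilMellin (weilConv g (weilReflect g)) s + weilMellin (weilConv g (weilReflect g)) (conj s)

section API

variable {a a' T₀ c₁ c₂ c₀ c₁' c₂' c₀' : ℝ} {ρ : ℕ → ℂ} {g k : ℝ → ℂ}

/-- Unfolding `weilAdversaryTerm` (definitional; `conj = starRingEnd ℂ`, so this is literally the
summand of `AdversarialWeilPositivity`). [folklore] -/
theorem weilAdversaryTerm_apply (g : ℝ → ℂ) (s : ℂ) :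
    weilAdversaryTerm g s = weilMellin (weilConv g (weilReflect g)) s +
      weilMellin (weilConv g (weilReflect g)) (starRingEnd ℂ s) :=
  rfl

/-- Admissibility is monotone in the band: a configuration within a narrower band is within any
pointwise wider band above `T₀`. [folklore] -/
theorem IsWeilAdversary.of_band_le (hρ : IsWeilAdversary T₀ c₁ c₂ c₀ ρ)
    (hband : ∀ T : ℝ, T₀ ≤ T → c₁ * Real.log T + c₂ * Real.log (Real.log T) + c₀ ≤
      c₁' * Real.log T + c₂' * Real.log (Real.log T) + c₀') :
    IsWeilAdversary T₀ c₁' c₂' c₀' ρ :=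
  ⟨hρ.strip, hρ.on_line, hρ.finite, fun T hT ↦ (hρ.band T hT).trans (hband T hT)⟩

/-- Unbundling: `AdversarialWeilPositivity` says that every admissible configuration gives a
non-negative symmetrised sum on every test function supported in `[-a, a]`. [folklore] -/
theorem adversarialWeilPositivity_iff :
    AdversarialWeilPositivity a T₀ c₁ c₂ c₀ ↔
      ∀ ρ : ℕ → ℂ, IsWeilAdversary T₀ c₁ c₂ c₀ ρ → ∀ g : ℝ → ℂ, IsWeilTest g →
        tsupport g ⊆ Icc (-a) a → 0 ≤ (∑' n, weilAdversaryTerm g (ρ n)).re :=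
  ⟨fun h ρ hρ g hg hs ↦ h ρ hρ.strip hρ.on_line hρ.finite hρ.band g hg hs,
    fun h ρ h₁ h₂ h₃ h₄ g hg hs ↦ h ρ ⟨h₁, h₂, h₃, h₄⟩ g hg hs⟩

/-- Elimination form of `adversarialWeilPositivity_iff`. [folklore] -/
theorem AdversarialWeilPositivity.nonneg (h : AdversarialWeilPositivity a T₀ c₁ c₂ c₀)
    (hρ : IsWeilAdversary T₀ c₁ c₂ c₀ ρ) (hg : IsWeilTest g) (hs : tsupport g ⊆ Icc (-a) a) :
    0 ≤ (∑' n, weilAdversaryTerm g (ρ n)).re :=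
  adversarialWeilPositivity_iff.1 h ρ hρ g hg hs

/-! ## Monotonicity -/

/-- `AdvPos` is antitone in the support: shrinking `a` only removes test functions. [folklore] -/
theorem AdversarialWeilPositivity.anti (h : AdversarialWeilPositivity a T₀ c₁ c₂ c₀) (ha : a' ≤ a) :
    AdversarialWeilPositivity a' T₀ c₁ c₂ c₀ :=
  fun ρ h₁ h₂ h₃ h₄ g hg hs ↦ h ρ h₁ h₂ h₃ h₄ g hg (hs.trans (Icc_subset_Icc (neg_le_neg ha) ha))

/-- `a ↦ AdvPos(a; T₀; c₁, c₂, c₀)` is antitone (for the order `P ≤ Q ↔ (P → Q)` on `Prop`).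
[folklore] -/
theorem antitone_adversarialWeilPositivity :
    Antitone fun a ↦ AdversarialWeilPositivity a T₀ c₁ c₂ c₀ :=
  fun _ _ hab h ↦ h.anti hab

/-- `AdvPos` is antitone in the band: if the band `(c₁, c₂, c₀)` is pointwise narrower than
`(c₁', c₂', c₀')` above `T₀`, every configuration admissible for the former is admissible for the
latter, so the statement with the wider band is the stronger one. [folklore] -/
theorem AdversarialWeilPositivity.of_band_le (h : AdversarialWeilPositivity a T₀ c₁' c₂' c₀')
    (hband : ∀ T : ℝ, T₀ ≤ T → c₁ * Real.log T + c₂ * Real.log (Real.log T) + c₀ ≤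
      c₁' * Real.log T + c₂' * Real.log (Real.log T) + c₀') :
    AdversarialWeilPositivity a T₀ c₁ c₂ c₀ :=
  fun ρ h₁ h₂ h₃ h₄ g hg hs ↦ h ρ h₁ h₂ h₃ (fun T hT ↦ (h₄ T hT).trans (hband T hT)) g hg hs

/-- `AdvPos` is antitone in each band constant once `T₀ ≥ e` (so that `log T ≥ 0` and
`log log T ≥ 0` for `T ≥ T₀`). [folklore] -/
theorem AdversarialWeilPositivity.anti_consts (h : AdversarialWeilPositivity a T₀ c₁' c₂' c₀')
    (hT₀ : Real.exp 1 ≤ T₀) (h₁ : c₁ ≤ c₁') (h₂ : c₂ ≤ c₂') (h₀ : c₀ ≤ c₀') :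
    AdversarialWeilPositivity a T₀ c₁ c₂ c₀ := by
  refine h.of_band_le fun T hT ↦ ?_
  have hT1 : Real.exp 1 ≤ T := hT₀.trans hT
  have hTpos : 0 < T := (Real.exp_pos 1).trans_le hT1
  have hlog : 1 ≤ Real.log T := by
    rw [Real.le_log_iff_exp_le hTpos]
    exact hT1
  have hloglog : 0 ≤ Real.log (Real.log T) := Real.log_nonneg hlog
  have hlog0 : 0 ≤ Real.log T := zero_le_one.trans hlog
  nlinarith [mul_le_mul_of_nonneg_right h₁ hlog0, mul_le_mul_of_nonneg_right h₂ hloglog]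

/-- `AdvPos` is antitone in the additive band constant `c₀`, unconditionally. [folklore] -/
theorem AdversarialWeilPositivity.anti_const (h : AdversarialWeilPositivity a T₀ c₁ c₂ c₀')
    (h₀ : c₀ ≤ c₀') : AdversarialWeilPositivity a T₀ c₁ c₂ c₀ :=
  h.of_band_le fun _ _ ↦ by linarith

/-! ## Degenerate supports -/

/-- The transform of the zero function vanishes. [folklore] -/
@[simp] theorem weilMellin_zero (s : ℂ) : weilMellin 0 s = 0 := by
  simp [weilMellin]

/-- The involution of the zero function is zero. [folklore] -/
@[simp] theorem weilReflect_zero : weilReflect (0 : ℝ → ℂ) = 0 := by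
  funext t
  simp [weilReflect]

/-- Convolution with the zero function on the left is zero. [folklore] -/
@[simp] theorem weilConv_zero_left (h : ℝ → ℂ) : weilConv 0 h = 0 := by
  simp [weilConv, zero_convolution]

/-- The symmetrised term of the zero test function vanishes. [folklore] -/
@[simp] theorem weilAdversaryTerm_zero (s : ℂ) : weilAdversaryTerm 0 s = 0 := by
  simp [weilAdversaryTerm]

/-- A test function supported in `[-a, a]` with `a ≤ 0` is identically zero (its support is open
and contained in a set with empty interior). [folklore] -/
theorem IsWeilTest.eq_zero_of_tsupport_subset (hg : IsWeilTest g) (hs : tsupport g ⊆ Icc (-a) a)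
    (ha : a ≤ 0) : g = 0 := by
  have hopen : IsOpen (Function.support g) := hg.1.continuous.isOpen_support
  have hsub : Function.support g ⊆ interior (Icc (-a) a) :=
    hopen.subset_interior_iff.2 ((subset_tsupport g).trans hs)
  rw [interior_Icc, Ioo_eq_empty (by linarith), subset_empty_iff] at hsub
  exact Function.support_eq_empty_iff.1 hsub

/-- For `a ≤ 0` adversarial Weil positivity holds trivially: the only admissible test function
is `0`, whose symmetrised sum is `0`. (Non-vacuity of the interesting range `a > 0` is the
content of the route.) [folklore] -/
theorem adversarialWeilPositivity_of_nonpos (ha : a ≤ 0) :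
    AdversarialWeilPositivity a T₀ c₁ c₂ c₀ := by
  rw [adversarialWeilPositivity_iff]
  intro ρ _ g hg hs
  rw [hg.eq_zero_of_tsupport_subset hs ha]
  simp

end API

/-! ## Junk-safety: the adversary sum converges absolutely

For an admissible configuration the two-sided band at consecutive integer heights `k, k + 1 ≥ T₀`
bounds the number of points in the shell `k < Im ρₙ ≤ k + 1` by `O(log k)`, which makes
`∑ₙ 1/(1 + (Im ρₙ)²)` converge; the strip decay `‖k̂(s)‖ ≤ C_k/(1 + (Im s)²)`
(`norm_weilMellin_le`) then gives absolute convergence of the adversary sum. -/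

section Counting

variable {γ : ℕ → ℝ}

/-- The integer shell of a height: for `γ n > 0` the `k : ℕ` with `k < γ n ≤ k + 1`
(`= ⌈γ n⌉₊ - 1`). [folklore] -/
def heightShell (γ : ℕ → ℝ) (n : ℕ) : ℕ := ⌈γ n⌉₊ - 1

/-- `γ n ≤ heightShell γ n + 1` (no hypothesis). [folklore] -/
theorem le_heightShell_add_one (γ : ℕ → ℝ) (n : ℕ) : γ n ≤ (heightShell γ n : ℝ) + 1 := by
  have h1 : γ n ≤ (⌈γ n⌉₊ : ℝ) := Nat.le_ceil _
  have h2 : ((⌈γ n⌉₊ : ℕ) : ℝ) ≤ ((⌈γ n⌉₊ - 1 : ℕ) : ℝ) + 1 := by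
    have : (⌈γ n⌉₊ : ℕ) ≤ (⌈γ n⌉₊ - 1) + 1 := by omega
    exact_mod_cast this
  exact h1.trans h2

/-- For a positive height, `heightShell γ n < γ n`. [folklore] -/
theorem heightShell_lt {n : ℕ} (h : 0 < γ n) : (heightShell γ n : ℝ) < γ n := by
  have h1 : 1 ≤ ⌈γ n⌉₊ := Nat.lt_ceil.2 (by simpa using h)
  have h2 : (⌈γ n⌉₊ : ℝ) < γ n + 1 := Nat.ceil_lt_add_one h.le
  unfold heightShell
  rw [Nat.cast_sub h1, Nat.cast_one]
  linarith

/-- Elementary estimate behind the comparison with `∑ (k+1)^{-3/2}`: for `x ≥ 0`,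
`(A log (x+1) + B)/(1 + x²) ≤ (2|A| + |B|) · 2 (x+1)^{-3/2}` (from `log y ≤ 2 √y` and
`(x+1)² ≤ 2 (1 + x²)`). [folklore] -/
theorem log_div_one_add_sq_le {x : ℝ} (hx : 0 ≤ x) (A B : ℝ) :
    (A * Real.log (x + 1) + B) / (1 + x ^ 2) ≤
      (2 * |A| + |B|) * (2 * (x + 1) ^ (-(3 / 2 : ℝ))) := by
  have hx1 : 0 < x + 1 := by linarith
  set y : ℝ := (x + 1) ^ (1 / 2 : ℝ) with hy
  have hy0 : 0 ≤ y := Real.rpow_nonneg hx1.le _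
  have hy1 : 1 ≤ y := Real.one_le_rpow (by linarith) (by norm_num)
  have hlog0 : 0 ≤ Real.log (x + 1) := Real.log_nonneg (by linarith)
  have hlog : Real.log (x + 1) ≤ 2 * y := by
    have h := Real.log_le_rpow_div hx1.le (by norm_num : (0 : ℝ) < 1 / 2)
    rw [← hy] at h
    linarith
  have hpow : (x + 1) ^ (-(3 / 2 : ℝ)) = y / (x + 1) ^ 2 := by
    rw [hy, show (-(3 / 2 : ℝ)) = 1 / 2 - 2 by norm_num, Real.rpow_sub hx1, Real.rpow_two]
  have hnum : A * Real.log (x + 1) + B ≤ (2 * |A| + |B|) * y := by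
    have hA : A * Real.log (x + 1) ≤ |A| * Real.log (x + 1) :=
      mul_le_mul_of_nonneg_right (le_abs_self A) hlog0
    have hA' : |A| * Real.log (x + 1) ≤ |A| * (2 * y) :=
      mul_le_mul_of_nonneg_left hlog (abs_nonneg A)
    have hB : B ≤ |B| * y := (le_abs_self B).trans (le_mul_of_one_le_right (abs_nonneg B) hy1)
    linarith
  have hP : 0 ≤ (2 * |A| + |B|) * y := by positivity
  rw [hpow, show (2 * |A| + |B|) * (2 * (y / (x + 1) ^ 2)) = (2 * ((2 * |A| + |B|) * y)) / (x + 1) ^ 2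
    by ring, div_le_div_iff₀ (by positivity) (by positivity)]
  have hsq : (x + 1) ^ 2 ≤ 2 * (1 + x ^ 2) := by nlinarith [sq_nonneg (x - 1)]
  calc (A * Real.log (x + 1) + B) * (x + 1) ^ 2
      ≤ ((2 * |A| + |B|) * y) * (x + 1) ^ 2 := mul_le_mul_of_nonneg_right hnum (by positivity)
    _ ≤ ((2 * |A| + |B|) * y) * (2 * (1 + x ^ 2)) := mul_le_mul_of_nonneg_left hsq hP
    _ = 2 * ((2 * |A| + |B|) * y) * (1 + x ^ 2) := by ring

/-- **Counting lemma.** Let `γ : ℕ → ℝ` be positive heights, locally finite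
(`{n | γ n ≤ T}` finite for every `T`), whose unit-shell counts satisfy
`#{γ ≤ k+1} - #{γ ≤ k} ≤ A log (k+1) + B` for all naturals `k ≥ K₀`. Then `∑ₙ 1/(1 + γₙ²) < ∞`.
(Group the terms by shells `k < γₙ ≤ k + 1`; a shell contributes at most its size times
`1/(1 + k²)`, and `∑ₖ (A log (k+1) + B)/(1 + k²) < ∞`.) [folklore] -/
theorem summable_one_div_one_add_sq_of_shell_le (hpos : ∀ n, 0 < γ n)
    (hfin : ∀ T : ℝ, {n | γ n ≤ T}.Finite) {K₀ : ℕ} {A B : ℝ}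
    (hcount : ∀ k : ℕ, K₀ ≤ k →
      ({n | γ n ≤ (k : ℝ) + 1}.ncard : ℝ) - ({n | γ n ≤ (k : ℝ)}.ncard : ℝ) ≤
        A * Real.log ((k : ℝ) + 1) + B) :
    Summable fun n ↦ 1 / (1 + γ n ^ 2) := by
  classical
  -- the shells and their sizes
  set S : ℕ → Set ℕ := fun k ↦ {n | heightShell γ n = k} with hS
  have hSsub : ∀ k, S k ⊆ {n | γ n ≤ (k : ℝ) + 1} := fun k n hn ↦ by
    simp only [hS, mem_setOf_eq] at hn ⊢
    rw [← hn]
    exact le_heightShell_add_one γ n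
  have hSfin : ∀ k, (S k).Finite := fun k ↦ (hfin _).subset (hSsub k)
  set w : ℕ → ℝ := fun k ↦ ((S k).ncard : ℝ) / (1 + (k : ℝ) ^ 2) with hw
  have hw0 : ∀ k, 0 ≤ w k := fun k ↦ by positivity
  -- (1) a shell has at most `N(k+1) - N(k)` elements
  have hshell : ∀ k : ℕ, ((S k).ncard : ℝ) ≤
      ({n | γ n ≤ (k : ℝ) + 1}.ncard : ℝ) - ({n | γ n ≤ (k : ℝ)}.ncard : ℝ) := by
    intro k
    have hdisj : Disjoint {n | γ n ≤ (k : ℝ)} (S k) := by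
      rw [Set.disjoint_left]
      intro n hn hnS
      simp only [hS, mem_setOf_eq] at hn hnS
      have h := heightShell_lt (hpos n)
      rw [hnS] at h
      linarith
    have hsub : {n | γ n ≤ (k : ℝ)} ∪ S k ⊆ {n | γ n ≤ (k : ℝ) + 1} :=
      union_subset (fun n (hn : γ n ≤ k) ↦ show γ n ≤ (k : ℝ) + 1 by linarith) (hSsub k)
    have h1 := Set.ncard_le_ncard hsub (hfin _)
    rw [Set.ncard_union_eq hdisj (hfin _) (hSfin k)] at h1
    have h2 : (({n | γ n ≤ (k : ℝ)}.ncard : ℕ) : ℝ) + ((S k).ncard : ℝ) ≤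
        ({n | γ n ≤ (k : ℝ) + 1}.ncard : ℝ) := by exact_mod_cast h1
    linarith
  -- (2) the shell bounds are summable
  have hwsum : Summable w := by
    have hcomp : Summable fun k : ℕ ↦ (2 * |A| + |B|) * (2 * ((k : ℝ) + 1) ^ (-(3 / 2 : ℝ))) := by
      refine Summable.mul_left _ (Summable.mul_left _ ?_)
      have h := (summable_nat_add_iff 1).2
        (Real.summable_nat_rpow.2 (by norm_num : (-(3 / 2 : ℝ)) < -1))
      simpa using h
    have hbound : ∀ k : ℕ, K₀ ≤ k →
        w k ≤ (2 * |A| + |B|) * (2 * ((k : ℝ) + 1) ^ (-(3 / 2 : ℝ))) := fun k hk ↦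
      (div_le_div_of_nonneg_right ((hshell k).trans (hcount k hk)) (by positivity)).trans
        (log_div_one_add_sq_le (Nat.cast_nonneg k) A B)
    rw [← summable_nat_add_iff K₀]
    refine Summable.of_nonneg_of_le (fun k ↦ hw0 _) (fun k ↦ ?_)
      ((summable_nat_add_iff K₀).2 hcomp)
    exact hbound (k + K₀) le_add_self
  -- (3) every finite partial sum is bounded by `∑' k, w k`
  refine summable_of_sum_le (c := ∑' k, w k) (fun n ↦ by positivity) fun u ↦ ?_
  calc ∑ n ∈ u, 1 / (1 + γ n ^ 2)
      = ∑ k ∈ u.image (heightShell γ), ∑ n ∈ u with heightShell γ n = k, 1 / (1 + γ n ^ 2) :=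
        (Finset.sum_fiberwise_of_maps_to (fun n hn ↦ Finset.mem_image_of_mem _ hn) _).symm
    _ ≤ ∑ k ∈ u.image (heightShell γ), w k := Finset.sum_le_sum fun k _ ↦ ?_
    _ ≤ ∑' k, w k := hwsum.sum_le_tsum _ fun k _ ↦ hw0 k
  -- the shell-`k` part of `u`
  have hterm : ∀ n ∈ u.filter (fun n ↦ heightShell γ n = k),
      1 / (1 + γ n ^ 2) ≤ 1 / (1 + (k : ℝ) ^ 2) := by
    intro n hn
    rw [Finset.mem_filter] at hn
    have h := heightShell_lt (hpos n)
    rw [hn.2] at h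
    have hk0 : (0 : ℝ) ≤ k := Nat.cast_nonneg k
    exact one_div_le_one_div_of_le (by positivity) (by nlinarith)
  have hcard : ((u.filter (fun n ↦ heightShell γ n = k)).card : ℝ) ≤ ((S k).ncard : ℝ) := by
    have hsub : ((u.filter (fun n ↦ heightShell γ n = k) : Finset ℕ) : Set ℕ) ⊆ S k := by
      intro n hn
      rw [Finset.mem_coe, Finset.mem_filter] at hn
      exact hn.2
    exact_mod_cast (Set.ncard_coe_finset _).symm.trans_le (Set.ncard_le_ncard hsub (hSfin k))
  calc ∑ n ∈ u with heightShell γ n = k, 1 / (1 + γ n ^ 2)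
      ≤ ∑ n ∈ u with heightShell γ n = k, 1 / (1 + (k : ℝ) ^ 2) := Finset.sum_le_sum hterm
    _ = ((u.filter (fun n ↦ heightShell γ n = k)).card : ℝ) * (1 / (1 + (k : ℝ) ^ 2)) := by
        rw [Finset.sum_const, nsmul_eq_mul]
    _ ≤ ((S k).ncard : ℝ) * (1 / (1 + (k : ℝ) ^ 2)) :=
        mul_le_mul_of_nonneg_right hcard (by positivity)
    _ = w k := by simp only [hw]; ring

end Counting

section Summability

variable {T₀ c₁ c₂ c₀ : ℝ} {ρ : ℕ → ℂ} {g k : ℝ → ℂ}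

/-- The increment of the Riemann–von Mangoldt main term `M(T) = (T/2π) log (T/2πe)` over a unit
interval: `M(x+1) - M(x) ≤ log (x+1)` for `x > 0` (from `log (1 + 1/x) ≤ 1/x` and
`log (2πe) ≥ 1`). [folklore] -/
theorem rvMain_succ_sub_le {x : ℝ} (hx : 0 < x) :
    (x + 1) / (2 * Real.pi) * Real.log ((x + 1) / (2 * Real.pi * Real.exp 1)) -
        x / (2 * Real.pi) * Real.log (x / (2 * Real.pi * Real.exp 1)) ≤ Real.log (x + 1) := by
  have hπ : 0 < Real.pi := Real.pi_pos
  have hπ3 : 3 < Real.pi := Real.pi_gt_three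
  have hC : 0 < 2 * Real.pi * Real.exp 1 := by positivity
  have hlogC : Real.log (2 * Real.pi * Real.exp 1) = Real.log (2 * Real.pi) + 1 := by
    rw [Real.log_mul (by positivity) (Real.exp_pos 1).ne', Real.log_exp]
  have hlog2π : 0 ≤ Real.log (2 * Real.pi) := Real.log_nonneg (by linarith)
  rw [Real.log_div (by linarith) hC.ne', Real.log_div hx.ne' hC.ne', hlogC]
  have hx1 : 0 < x + 1 := by linarith
  have hlx1 : 0 ≤ Real.log (x + 1) := Real.log_nonneg (by linarith)
  -- `x (log (x+1) - log x) ≤ 1`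
  have hdiff : x * (Real.log (x + 1) - Real.log x) ≤ 1 := by
    have h : Real.log ((x + 1) / x) ≤ (x + 1) / x - 1 := Real.log_le_sub_one_of_pos (by positivity)
    rw [Real.log_div hx1.ne' hx.ne'] at h
    have h' : (x + 1) / x - 1 = 1 / x := by field_simp; ring
    rw [h'] at h
    calc x * (Real.log (x + 1) - Real.log x) ≤ x * (1 / x) :=
          mul_le_mul_of_nonneg_left h hx.le
      _ = 1 := by field_simp
  -- clear the denominator `2π`
  rw [div_mul_eq_mul_div, div_mul_eq_mul_div, ← sub_div, div_le_iff₀ (by positivity)]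
  nlinarith

/-- Above `e` the band is dominated by its absolute constants:
`c₁ log T + c₂ log log T + c₀ ≤ (|c₁| + |c₂|) log T + |c₀|` for `T ≥ e`
(`0 ≤ log log T ≤ log T`). [folklore] -/
theorem band_le_abs {T : ℝ} (hT : Real.exp 1 ≤ T) (c₁ c₂ c₀ : ℝ) :
    c₁ * Real.log T + c₂ * Real.log (Real.log T) + c₀ ≤ (|c₁| + |c₂|) * Real.log T + |c₀| := by
  have hTpos : 0 < T := (Real.exp_pos 1).trans_le hT
  have hlog : 1 ≤ Real.log T := by
    rw [Real.le_log_iff_exp_le hTpos]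
    exact hT
  have hlog0 : 0 ≤ Real.log T := zero_le_one.trans hlog
  have hll0 : 0 ≤ Real.log (Real.log T) := Real.log_nonneg hlog
  have hll : Real.log (Real.log T) ≤ Real.log T := by
    have := Real.log_le_sub_one_of_pos (zero_lt_one.trans_le hlog)
    linarith
  have h1 : c₁ * Real.log T ≤ |c₁| * Real.log T := mul_le_mul_of_nonneg_right (le_abs_self _) hlog0
  have h2 : c₂ * Real.log (Real.log T) ≤ |c₂| * Real.log (Real.log T) :=
    mul_le_mul_of_nonneg_right (le_abs_self _) hll0
  have h3 : |c₂| * Real.log (Real.log T) ≤ |c₂| * Real.log T :=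
    mul_le_mul_of_nonneg_left hll (abs_nonneg _)
  have h4 : c₀ ≤ |c₀| := le_abs_self _
  linarith

/-- Upper count: for `T ≥ T₀` an admissible configuration has at most
`(T/2π) log (T/2πe) + (c₁ log T + c₂ log log T + c₀)` points of height `≤ T`. [folklore] -/
theorem IsWeilAdversary.count_le (hρ : IsWeilAdversary T₀ c₁ c₂ c₀ ρ) {T : ℝ} (hT : T₀ ≤ T) :
    ({n | (ρ n).im ≤ T}.ncard : ℝ) ≤ T / (2 * Real.pi) * Real.log (T / (2 * Real.pi * Real.exp 1)) +
      (c₁ * Real.log T + c₂ * Real.log (Real.log T) + c₀) := by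
  have h := (abs_le.1 (hρ.band T hT)).2
  linarith

/-- Lower count: for `T ≥ T₀` an admissible configuration has at least
`(T/2π) log (T/2πe) - (c₁ log T + c₂ log log T + c₀)` points of height `≤ T`. [folklore] -/
theorem IsWeilAdversary.sub_le_count (hρ : IsWeilAdversary T₀ c₁ c₂ c₀ ρ) {T : ℝ} (hT : T₀ ≤ T) :
    T / (2 * Real.pi) * Real.log (T / (2 * Real.pi * Real.exp 1)) -
      (c₁ * Real.log T + c₂ * Real.log (Real.log T) + c₀) ≤ ({n | (ρ n).im ≤ T}.ncard : ℝ) := by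
  have h := (abs_le.1 (hρ.band T hT)).1
  linarith

/-- **Shell counts are logarithmic**: for an admissible configuration and an integer
`k ≥ max T₀ e`, `#{Im ρ ≤ k+1} - #{Im ρ ≤ k} ≤ (1 + 2(|c₁| + |c₂|)) log (k+1) + 2|c₀|`
(band at `k` and `k + 1`, `rvMain_succ_sub_le`, `band_le_abs`). [folklore] -/
theorem IsWeilAdversary.shell_count_le (hρ : IsWeilAdversary T₀ c₁ c₂ c₀ ρ) {k : ℕ}
    (hk : max T₀ (Real.exp 1) ≤ k) :
    ({n | (ρ n).im ≤ (k : ℝ) + 1}.ncard : ℝ) - ({n | (ρ n).im ≤ (k : ℝ)}.ncard : ℝ) ≤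
      (1 + 2 * (|c₁| + |c₂|)) * Real.log ((k : ℝ) + 1) + 2 * |c₀| := by
  have hT₀ : T₀ ≤ k := (le_max_left _ _).trans hk
  have he : Real.exp 1 ≤ k := (le_max_right _ _).trans hk
  have hkpos : (0 : ℝ) < k := (Real.exp_pos 1).trans_le he
  have hup := hρ.count_le (T := (k : ℝ) + 1) (by linarith)
  have hlow := hρ.sub_le_count (T := (k : ℝ)) hT₀
  have hM := rvMain_succ_sub_le hkpos
  have hB1 := band_le_abs (T := (k : ℝ) + 1) (by linarith) c₁ c₂ c₀
  have hB0 := band_le_abs (T := (k : ℝ)) he c₁ c₂ c₀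
  have hlogmono : Real.log (k : ℝ) ≤ Real.log ((k : ℝ) + 1) :=
    Real.log_le_log hkpos (by linarith)
  have habs : 0 ≤ |c₁| + |c₂| := by positivity
  nlinarith [mul_le_mul_of_nonneg_left hlogmono habs]

/-- **`∑ₙ 1/(1 + (Im ρₙ)²) < ∞` for every admissible configuration** (counting lemma
`summable_one_div_one_add_sq_of_shell_le` with the logarithmic shell counts). [folklore] -/
theorem IsWeilAdversary.summable_one_div_one_add_im_sq (hρ : IsWeilAdversary T₀ c₁ c₂ c₀ ρ) :
    Summable fun n ↦ 1 / (1 + (ρ n).im ^ 2) :=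
  summable_one_div_one_add_sq_of_shell_le (γ := fun n ↦ (ρ n).im) (fun n ↦ (hρ.strip n).2.2)
    hρ.finite (K₀ := ⌈max T₀ (Real.exp 1)⌉₊) (A := 1 + 2 * (|c₁| + |c₂|)) (B := 2 * |c₀|)
    fun k hk ↦ hρ.shell_count_le ((Nat.le_ceil _).trans (by exact_mod_cast hk))

/-- For an admissible configuration and any test function `k`, `∑ₙ ‖k̂(ρₙ)‖ < ∞`
(`norm_weilMellin_le` in the closed strip and `summable_one_div_one_add_im_sq`). [folklore] -/
theorem IsWeilAdversary.summable_norm_weilMellin (hρ : IsWeilAdversary T₀ c₁ c₂ c₀ ρ)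
    (hk : IsWeilTest k) : Summable fun n ↦ ‖weilMellin k (ρ n)‖ := by
  refine Summable.of_nonneg_of_le (fun _ ↦ norm_nonneg _) (fun n ↦ ?_)
    (hρ.summable_one_div_one_add_im_sq.mul_left (weilDecayConst k))
  have h := norm_weilMellin_le hk (s := ρ n) (hρ.strip n).1.le (hρ.strip n).2.1.le
  exact h.trans_eq (by ring)

/-- The same at the conjugate points: `∑ₙ ‖k̂(ρ̄ₙ)‖ < ∞`. [folklore] -/
theorem IsWeilAdversary.summable_norm_weilMellin_conj (hρ : IsWeilAdversary T₀ c₁ c₂ c₀ ρ)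
    (hk : IsWeilTest k) : Summable fun n ↦ ‖weilMellin k (conj (ρ n))‖ := by
  refine Summable.of_nonneg_of_le (fun _ ↦ norm_nonneg _) (fun n ↦ ?_)
    (hρ.summable_one_div_one_add_im_sq.mul_left (weilDecayConst k))
  have h := norm_weilMellin_le hk (s := conj (ρ n))
    (by rw [Complex.conj_re]; exact (hρ.strip n).1.le)
    (by rw [Complex.conj_re]; exact (hρ.strip n).2.1.le)
  rw [Complex.conj_im, neg_sq] at h
  exact h.trans_eq (by ring)

/-- **Absolute convergence of the adversary sum**: for an admissible configuration and a test
function `g`, `∑ₙ ‖k̂(ρₙ) + k̂(ρ̄ₙ)‖ < ∞` with `k = g ⋆ g̃`. [folklore] -/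
theorem IsWeilAdversary.summable_norm_weilAdversaryTerm (hρ : IsWeilAdversary T₀ c₁ c₂ c₀ ρ)
    (hg : IsWeilTest g) : Summable fun n ↦ ‖weilAdversaryTerm g (ρ n)‖ := by
  have hk : IsWeilTest (weilConv g (weilReflect g)) := hg.weilConv hg.weilReflect
  exact Summable.of_nonneg_of_le (fun _ ↦ norm_nonneg _) (fun n ↦ norm_add_le _ _)
    ((hρ.summable_norm_weilMellin hk).add (hρ.summable_norm_weilMellin_conj hk))

/-- The adversary sum of an admissible configuration converges. [folklore] -/
theorem IsWeilAdversary.summable_weilAdversaryTerm (hρ : IsWeilAdversary T₀ c₁ c₂ c₀ ρ)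
    (hg : IsWeilTest g) : Summable fun n ↦ weilAdversaryTerm g (ρ n) :=
  (hρ.summable_norm_weilAdversaryTerm hg).of_norm

/-- For an admissible configuration the real part may be taken termwise:
`Re ∑'ₙ (k̂(ρₙ) + k̂(ρ̄ₙ)) = ∑'ₙ Re (k̂(ρₙ) + k̂(ρ̄ₙ))`. [folklore] -/
theorem IsWeilAdversary.re_tsum_weilAdversaryTerm (hρ : IsWeilAdversary T₀ c₁ c₂ c₀ ρ)
    (hg : IsWeilTest g) :
    (∑' n, weilAdversaryTerm g (ρ n)).re = ∑' n, (weilAdversaryTerm g (ρ n)).re :=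
  Complex.re_tsum (hρ.summable_weilAdversaryTerm hg)

end Summability

end Literature.NumberTheory.LFunctions

end
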